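import Mathlib
import HarnessLib
import Literature.Probability.LatticeModels.IsingThermodynamics
import Literature.Probability.LatticeModels.CriticalTwoPointLower
import Literature.Probability.LatticeModels.HighDimPointwiseTriviality
import Summits.CriticalPhenomena.Ising3DConformalLimit.Theorems.HyperoctahedralRPCriticalCorrNineMirrorRP

/-!
# Stub `stub_dcfStructure` (line `self-energy-pick-inversion`, crux `PrecisionLaplacian.DirectCorrelationStableTail`,
# stmt-CriticalPhenomena-4799) — auxiliary file 1: the reflection-positivity cross bound

Registered helper sub-goal `stub_dcfStructure_auxCrossBound`.  For the critical two-point function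
`G = ⟨σ₀σ_x⟩⁺_{β_c}` of the nearest-neighbour Ising model on `ℤ³`, a coordinate `i`, a finite set
`S ⊂ {x : x_i ≥ 2}` and real weights `w`, if all finite kernel matrices `G_A = (G(q - p))_{p,q ∈ A}` are
positive definite then the cross term `C = Σ_{s ∈ S} w_s G(s)` of the quadratic form of `G_{{0} ∪ S}` obeys

  `C² ≤ G(2e_i) · Σ_{s,s' ∈ S} w_s w_{s'} G(s' - s)`.

Proof (Fröhlich–Israel–Lieb–Simon reflection positivity + Cauchy–Schwarz twice, `cross_sq_le`, stated for an
arbitrary kernel `G` that is even, invariant under the sign change `θ_i` of the `i`-th coordinate, reflection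
positive through the plane `x_i = 0` and with positive semidefinite Gram forms):
* nine-mirror reflection positivity of the critical correlators (item stmt-CriticalPhenomena-1985, PROVED:
  `HyperoctahedralRPNineMirror.criticalCorrNineMirrorRP_proof`), specialised to pair correlations
  (`criticalCorr_two_pair`), says that `N_{ab} = G(p_b - θ_i p_a)` is a positive semidefinite kernel on every
  finite family of points strictly inside `{x_i > 0}` (`rp_nonneg`); take the points `e_i` and `s - e_i`,
  `s ∈ S`;
* Cauchy–Schwarz for `N` (`sq_cross_le_of_psd`, discriminant of `t ↦ N(x + t y, x + t y) ≥ 0`) between the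
  indicator of `e_i` and `w` transported to `{s - e_i}`: `N(e_i, s - e_i) = G(s)`, `N(e_i, e_i) = G(2e_i)`,
  `N(s - e_i, s' - e_i) = G(s' - θ'_i s)` with `θ'_i` the mirror through `x_i = 1`, so
  `C² ≤ G(2e_i) · D`, `D = Σ w_s w_{s'} G(s' - θ'_i s)`;
* Cauchy–Schwarz for the Gram form of `G` on the family `S ⊔ θ'_i S` (positive semidefinite with repetitions
  allowed, `gram_nonneg`, from `Matrix.PosSemidef.submatrix`) between `w` on `S` and `w ∘ θ'_i` on `θ'_i S`:
  `D² ≤ B · B'` with `B = Σ w_s w_{s'} G(s' - s)` and `B' = Σ w_s w_{s'} G(θ'_i s' - θ'_i s) = B`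
  (`θ'_i s' - θ'_i s = θ_i (s' - s)` and `G ∘ θ_i = G`), whence `D ≤ B` and `C² ≤ G(2e_i) B`.
Also recorded here: `G x < G 0` for `x ≠ 0` from positive definiteness of the `2 × 2` blocks
(`apply_lt_apply_zero`), used by the stub for `κ_i = 1 - G(2e_i) > 0`.

Pure theorem file (no definitions).  References: J. Fröhlich, R. Israel, E. H. Lieb, B. Simon, *Phase
transitions and reflection positivity I*, Comm. Math. Phys. 62 (1978) 1–34, §3 Thm. 3.1
[FrohlichIsraelLiebSimon1978]; C. Dellacherie, S. Martínez, J. San Martín, *Inverse M-matrices and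
ultrametric matrices*, LNM 2118 (2014), ch. 2 [DellacherieMartinezSanmartin2014]; S. Friedli, Y. Velenik,
*Statistical Mechanics of Lattice Systems* (CUP 2017), Lemma 10.8 and Exercise 3.14.
-/

noncomputable section

namespace Summit.CriticalPhenomena.Ising3DConformalLimit.Cruxes.DirectCorrelationStableTail.SelfEnergyPickInversion

open scoped BigOperators
open Literature.Probability.LatticeModels

/-- **Cauchy–Schwarz for a positive semidefinite symmetric kernel** on a finite index type:
`(Σ x_a y_b K_{ab})² ≤ (Σ x_a x_b K_{ab}) (Σ y_a y_b K_{ab})` (discriminant of `t ↦ Q(x + t y) ≥ 0`). -/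
theorem sq_cross_le_of_psd {ι : Type*} [Fintype ι] (K : ι → ι → ℝ) (hsymm : ∀ a b, K a b = K b a)
    (hpsd : ∀ c : ι → ℝ, 0 ≤ ∑ a, ∑ b, c a * c b * K a b) (x y : ι → ℝ) :
    (∑ a, ∑ b, x a * y b * K a b) ^ 2 ≤
      (∑ a, ∑ b, x a * x b * K a b) * (∑ a, ∑ b, y a * y b * K a b) := by
  have hB' : ∑ a, ∑ b, y a * x b * K a b = ∑ a, ∑ b, x a * y b * K a b := by
    rw [Finset.sum_comm]
    refine Finset.sum_congr rfl fun a _ => Finset.sum_congr rfl fun b _ => ?_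
    rw [hsymm]
    ring
  have hquad : ∀ t : ℝ, 0 ≤ (∑ a, ∑ b, y a * y b * K a b) * (t * t) +
      (2 * ∑ a, ∑ b, x a * y b * K a b) * t + ∑ a, ∑ b, x a * x b * K a b := by
    intro t
    have h := hpsd (fun a => x a + t * y a)
    have hexp : ∑ a, ∑ b, (x a + t * y a) * (x b + t * y b) * K a b =
        ∑ a, ∑ b, x a * x b * K a b + t * ∑ a, ∑ b, x a * y b * K a b +
          t * ∑ a, ∑ b, y a * x b * K a b + t * t * ∑ a, ∑ b, y a * y b * K a b := by
      simp only [Finset.mul_sum, ← Finset.sum_add_distrib]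
      refine Finset.sum_congr rfl fun a _ => Finset.sum_congr rfl fun b _ => ?_
      ring
    rw [hexp, hB'] at h
    nlinarith [h]
  have hd := discrim_le_zero hquad
  rw [discrim] at hd
  nlinarith [hd]

/-- The Gram forms `Σ_{ab} c_a c_b G(p_b - p_a)` of a kernel all of whose finite kernel matrices
`(G (q - p))_{p,q ∈ A}` are positive semidefinite are nonnegative, for finite families of points `p_a`
with repetitions allowed (`Matrix.PosSemidef.submatrix`). -/
theorem gram_nonneg (G : Site 3 → ℝ)
    (hpsd : ∀ A : Finset (Site 3), (Matrix.of fun (p q : ↥A) => G (q.1 - p.1)).PosSemidef)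
    {ι : Type*} [Fintype ι] (p : ι → Site 3) (c : ι → ℝ) :
    0 ≤ ∑ a, ∑ b, c a * c b * G (p b - p a) := by
  classical
  let A : Finset (Site 3) := Finset.univ.image p
  let idx : ι → ↥A := fun a => ⟨p a, Finset.mem_image_of_mem p (Finset.mem_univ a)⟩
  have h := ((hpsd A).submatrix idx).dotProduct_mulVec_nonneg c
  have e : star c ⬝ᵥ ((Matrix.of fun (p q : ↥A) => G (q.1 - p.1)).submatrix idx idx).mulVec c =
      ∑ a, ∑ b, c a * c b * G (p b - p a) := by
    simp only [star_trivial, dotProduct, Matrix.mulVec, Matrix.submatrix_apply, Matrix.of_apply,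
      Finset.mul_sum, idx]
    refine Finset.sum_congr rfl fun a _ => Finset.sum_congr rfl fun b _ => ?_
    ring
  rw [e] at h
  exact h

/-- `Fin.append` of two one-point configurations is the pair `![u, w]`. -/
theorem fin_append_one_one {α : Type*} (u w : α) :
    (Fin.append (fun _ : Fin 1 => u) (fun _ : Fin 1 => w) : Fin 2 → α) = ![u, w] := by
  funext l
  fin_cases l <;> rfl

open Summit.CriticalPhenomena.Ising3DConformalLimit.HyperoctahedralRPNineMirror in
/-- **Reflection positivity of the critical two-point function through a coordinate plane** (item 1985,
`criticalCorrNineMirrorRP_proof`, FILS 1978 Thm 3.1, specialised to pair correlations): for finitely many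
points `p_a` with `(p_a)_i > 0` and real `c_a`, `Σ_{ab} c_a c_b G(p_b - θ_i p_a) ≥ 0`, `θ_i` the sign change of
the `i`-th coordinate. -/
theorem rp_nonneg (i : Fin 3) {ι : Type*} [Fintype ι] (p : ι → Site 3) (hp : ∀ a, 0 < p a i)
    (c : ι → ℝ) :
    0 ≤ ∑ a, ∑ b, c a * c b *
      criticalTwoPoint 3 (p b - Function.update (p a) i (-(p a i))) := by
  classical
  obtain ⟨j, hj⟩ := exists_ne i
  set σ := Fintype.equivFin ι
  have hRP := criticalCorrNineMirrorRP_proof (fun x => Function.update x i (-x i)) (fun x => x i)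
    ⟨i, j, hj.symm, Or.inl ⟨rfl, rfl⟩⟩ (Fintype.card ι) (fun _ => 1) (fun a _ => p (σ.symm a))
    (fun a => c (σ.symm a)) (fun a _ => hp (σ.symm a))
  have key : ∀ u w : Site 3, criticalCorr 3 (1 + 1) (Fin.append (fun _ : Fin 1 => u) (fun _ : Fin 1 => w)) =
      criticalTwoPoint 3 (w - u) := by
    intro u w
    rw [← criticalCorr_two_pair, ← fin_append_one_one]
  simp only [key] at hRP
  calc (0 : ℝ) ≤ _ := hRP
    _ = ∑ a, ∑ b : Fin (Fintype.card ι), c a * c (σ.symm b) *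
          criticalTwoPoint 3 (p (σ.symm b) - Function.update (p a) i (-(p a i))) :=
        Fintype.sum_equiv σ.symm _ _ (fun _ => rfl)
    _ = _ := Finset.sum_congr rfl fun a _ => Fintype.sum_equiv σ.symm _ _ (fun _ => rfl)

/-- `|G x| < G 0`-type consequence of positive definiteness: if all finite kernel matrices of an even kernel
`G` are positive definite then `G x < G 0` for `x ≠ 0` (test vector `δ_0 - δ_x` on `A = {0, x}`). -/
theorem apply_lt_apply_zero (G : Site 3 → ℝ)
    (hpd : ∀ A : Finset (Site 3), (Matrix.of fun (p q : ↥A) => G (q.1 - p.1)).PosDef)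
    (heven : ∀ x, G (-x) = G x) {x : Site 3} (hx : x ≠ 0) : G x < G 0 := by
  classical
  have hx0 : (0 : Site 3) ∉ ({x} : Finset (Site 3)) := by simpa using hx.symm
  have h0A : (0 : Site 3) ∈ ({0, x} : Finset (Site 3)) := by simp
  let w : Site 3 → ℝ := fun y => if y = 0 then 1 else -1
  let v : ↥({0, x} : Finset (Site 3)) → ℝ := fun p => w p.1
  have hv : v ≠ 0 := by
    intro h
    have := congrFun h ⟨0, h0A⟩
    simp [v, w] at this
  have hpos := (hpd {0, x}).dotProduct_mulVec_pos hv
  rw [star_trivial] at hpos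
  have hform : v ⬝ᵥ (Matrix.of fun (p q : ↥({0, x} : Finset (Site 3))) => G (q.1 - p.1)).mulVec v =
      ∑ p ∈ ({0, x} : Finset (Site 3)), w p * ∑ q ∈ ({0, x} : Finset (Site 3)), G (q - p) * w q := by
    simp only [dotProduct, Matrix.mulVec, Matrix.of_apply, v]
    rw [← Finset.sum_coe_sort ({0, x} : Finset (Site 3))]
    refine Finset.sum_congr rfl fun p _ => ?_
    rw [← Finset.sum_coe_sort ({0, x} : Finset (Site 3))]
  rw [hform] at hpos
  simp only [Finset.sum_insert hx0, Finset.sum_singleton, w, if_neg hx, sub_zero, sub_self,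
    zero_sub, heven] at hpos
  simp at hpos
  linarith


/-- `θ_i e_i = -e_i` for the sign change `θ_i` of the `i`-th coordinate and the unit vector `e_i`. -/
theorem update_single_one_neg (i : Fin 3) :
    Function.update (Pi.single i (1 : ℤ) : Site 3) i (-((Pi.single i (1 : ℤ) : Site 3) i)) =
      -(Pi.single i (1 : ℤ) : Site 3) := by
  funext k
  by_cases hk : k = i
  · subst hk; simp
  · simp [hk]

/-- `e_i + e_i = 2 e_i`. -/
theorem single_one_add_single_one (i : Fin 3) :
    (Pi.single i (1 : ℤ) : Site 3) + Pi.single i (1 : ℤ) = Pi.single i (2 : ℤ) := by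
  rw [← Pi.single_add]; norm_num

/-- `(s' - e_i) - θ_i (s - e_i) = s' - θ'_i s`, where `θ'_i` is the mirror through the plane `x_i = 1`. -/
theorem sub_single_sub_update (i : Fin 3) (s s' : Site 3) :
    (s' - (Pi.single i (1 : ℤ) : Site 3)) - Function.update (s - (Pi.single i (1 : ℤ) : Site 3)) i
        (-((s - (Pi.single i (1 : ℤ) : Site 3)) i)) = s' - Function.update s i (2 - s i) := by
  funext k
  by_cases hk : k = i
  · subst hk; simp only [Pi.sub_apply, Function.update_self, Pi.single_eq_same]; ring
  · simp [hk]

/-- `θ'_i s' - θ'_i s = θ_i (s' - s)` (`θ'_i` the mirror through `x_i = 1`, `θ_i` the one through `x_i = 0`). -/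
theorem update_sub_update (i : Fin 3) (s s' : Site 3) :
    Function.update s' i (2 - s' i) - Function.update s i (2 - s i) =
      Function.update (s' - s) i (-((s' - s) i)) := by
  funext k
  by_cases hk : k = i
  · subst hk; simp only [Pi.sub_apply, Function.update_self]; ring
  · simp [hk]

/-- `θ_i (u - θ_i v) = θ_i u - v`. -/
theorem update_sub_update_neg (i : Fin 3) (u v : Site 3) :
    Function.update (u - Function.update v i (-v i)) i (-((u - Function.update v i (-v i)) i)) =
      Function.update u i (-u i) - v := by
  funext k
  by_cases hk : k = i
  · subst hk; simp only [Pi.sub_apply, Function.update_self]; ring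
  · simp [hk]

/-- **The reflection-positivity bound on the cross term** `C = Σ_s w_s G(s)` of the quadratic form of
`G_{{0} ∪ S}`, `S ⊂ {x_i ≥ 2}`: `C² ≤ G(2e_i) · Σ_{s,s'} w_s w_{s'} G(s' - s)`.  Reflection positivity through
`x_i = 0` makes `N_{ab} = G(p_b - θ_i p_a)` positive semidefinite on the points `e_i`, `s - e_i`; Cauchy–Schwarz
for `N` between `δ_{e_i}` and `w` gives `C² ≤ G(2e_i) Σ w_s w_{s'} G(s' - θ'_i s)`, and Cauchy–Schwarz for the
Gram form of `G` on `S ⊔ θ'_i S` with `G ∘ θ_i = G` bounds the last sum by `Σ w_s w_{s'} G(s' - s)`. -/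
theorem cross_sq_le (G : Site 3 → ℝ) (i : Fin 3)
    (hrefl : ∀ x : Site 3, G (Function.update x i (-x i)) = G x) (heven : ∀ x, G (-x) = G x)
    (hrp : ∀ {ι : Type} [Fintype ι] (p : ι → Site 3) (c : ι → ℝ), (∀ a, 0 < p a i) →
      0 ≤ ∑ a, ∑ b, c a * c b * G (p b - Function.update (p a) i (-(p a i))))
    (hgram : ∀ {ι : Type} [Fintype ι] (p : ι → Site 3) (c : ι → ℝ),
      0 ≤ ∑ a, ∑ b, c a * c b * G (p b - p a))
    (S : Finset (Site 3)) (hS : ∀ s ∈ S, 2 ≤ s i) (w : Site 3 → ℝ) :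
    (∑ s ∈ S, w s * G s) ^ 2 ≤
      G (Pi.single i 2) * ∑ s ∈ S, ∑ s' ∈ S, w s * w s' * G (s' - s) := by
  classical
  /- Step 1: reflection positivity on the points `e_i`, `s - e_i`. -/
  let P : Option ↥S → Site 3 := fun o => o.elim (Pi.single i 1) (fun s => s.1 - Pi.single i 1)
  have hP : ∀ o, 0 < P o i := by
    rintro (_ | s)
    · simp [P]
    · have := hS s.1 s.2
      simp [P]
      linarith
  let KN : Option ↥S → Option ↥S → ℝ := fun a b => G (P b - Function.update (P a) i (-(P a i)))
  have hKN_symm : ∀ a b, KN a b = KN b a := by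
    intro a b
    show G (P b - Function.update (P a) i (-(P a i))) = G (P a - Function.update (P b) i (-(P b i)))
    conv_rhs => rw [← hrefl, update_sub_update_neg, ← heven, neg_sub]
  have hKN_psd : ∀ c : Option ↥S → ℝ, 0 ≤ ∑ a, ∑ b, c a * c b * KN a b := fun c => hrp P c hP
  have hCS1 := sq_cross_le_of_psd KN hKN_symm hKN_psd (fun o => o.elim 1 (fun _ => 0))
    (fun o => o.elim 0 (fun s => w s.1))
  have e1 : ∑ a, ∑ b, (Option.elim a 1 fun _ => (0 : ℝ)) * (Option.elim b 0 fun s => w s.1) * KN a b =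
      ∑ s ∈ S, w s * G s := by
    simp only [Fintype.sum_option, Option.elim_none, Option.elim_some, zero_mul, mul_zero, one_mul,
      Finset.sum_const_zero, add_zero, zero_add]
    simp only [KN, P, Option.elim_none, Option.elim_some, update_single_one_neg, sub_neg_eq_add,
      sub_add_cancel]
    exact Finset.sum_coe_sort S (fun s => w s * G s)
  have e2 : ∑ a, ∑ b, (Option.elim a 1 fun _ => (0 : ℝ)) * (Option.elim b 1 fun _ => (0 : ℝ)) * KN a b =
      G (Pi.single i 2) := by
    simp only [Fintype.sum_option, Option.elim_none, Option.elim_some, zero_mul, mul_zero, one_mul,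
      Finset.sum_const_zero, add_zero]
    simp only [KN, P, Option.elim_none, update_single_one_neg, sub_neg_eq_add, single_one_add_single_one]
  have e3 : ∑ a, ∑ b, (Option.elim a 0 fun s => w s.1) * (Option.elim b 0 fun s => w s.1) * KN a b =
      ∑ s ∈ S, ∑ s' ∈ S, w s * w s' * G (s' - Function.update s i (2 - s i)) := by
    simp only [Fintype.sum_option, Option.elim_none, Option.elim_some, zero_mul, mul_zero,
      Finset.sum_const_zero, zero_add]
    simp only [KN, P, Option.elim_some, sub_single_sub_update]
    rw [← Finset.sum_coe_sort S]
    refine Finset.sum_congr rfl fun a _ => ?_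
    rw [← Finset.sum_coe_sort S]
  rw [e1, e2, e3] at hCS1
  have ha : 0 ≤ G (Pi.single i 2) := by rw [← e2]; exact hKN_psd _
  /- Step 2: Cauchy–Schwarz for the Gram form on `S ⊔ θ'_i S`. -/
  let P2 : ↥S ⊕ ↥S → Site 3 := Sum.elim (fun s => s.1) (fun s => Function.update s.1 i (2 - s.1 i))
  let KG : (↥S ⊕ ↥S) → (↥S ⊕ ↥S) → ℝ := fun a b => G (P2 b - P2 a)
  have hKG_symm : ∀ a b, KG a b = KG b a := fun a b => by
    show G (P2 b - P2 a) = G (P2 a - P2 b)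
    rw [← heven, neg_sub]
  have hKG_psd : ∀ c : ↥S ⊕ ↥S → ℝ, 0 ≤ ∑ a, ∑ b, c a * c b * KG a b := fun c => hgram P2 c
  have hCS2 := sq_cross_le_of_psd KG hKG_symm hKG_psd (Sum.elim (fun _ => 0) (fun s => w s.1))
    (Sum.elim (fun s => w s.1) (fun _ => 0))
  have f1 : ∑ a, ∑ b, Sum.elim (fun _ => (0 : ℝ)) (fun s => w s.1) a *
      Sum.elim (fun s => w s.1) (fun _ => (0 : ℝ)) b * KG a b =
      ∑ s ∈ S, ∑ s' ∈ S, w s * w s' * G (s' - Function.update s i (2 - s i)) := by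
    simp only [Fintype.sum_sum_type, Sum.elim_inl, Sum.elim_inr, zero_mul, mul_zero,
      Finset.sum_const_zero, zero_add, add_zero]
    simp only [KG, P2, Sum.elim_inl, Sum.elim_inr]
    rw [← Finset.sum_coe_sort S]
    refine Finset.sum_congr rfl fun a _ => ?_
    rw [← Finset.sum_coe_sort S]
  have f2 : ∑ a, ∑ b, Sum.elim (fun _ => (0 : ℝ)) (fun s => w s.1) a *
      Sum.elim (fun _ => (0 : ℝ)) (fun s => w s.1) b * KG a b =
      ∑ s ∈ S, ∑ s' ∈ S, w s * w s' * G (s' - s) := by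
    simp only [Fintype.sum_sum_type, Sum.elim_inl, Sum.elim_inr, zero_mul, mul_zero,
      Finset.sum_const_zero, zero_add]
    simp only [KG, P2, Sum.elim_inr, update_sub_update, hrefl]
    rw [← Finset.sum_coe_sort S]
    refine Finset.sum_congr rfl fun a _ => ?_
    rw [← Finset.sum_coe_sort S]
  have f3 : ∑ a, ∑ b, Sum.elim (fun s => w s.1) (fun _ => (0 : ℝ)) a *
      Sum.elim (fun s => w s.1) (fun _ => (0 : ℝ)) b * KG a b =
      ∑ s ∈ S, ∑ s' ∈ S, w s * w s' * G (s' - s) := by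
    simp only [Fintype.sum_sum_type, Sum.elim_inl, Sum.elim_inr, zero_mul, mul_zero,
      Finset.sum_const_zero, add_zero]
    simp only [KG, P2, Sum.elim_inl]
    rw [← Finset.sum_coe_sort S]
    refine Finset.sum_congr rfl fun a _ => ?_
    rw [← Finset.sum_coe_sort S]
  rw [f1, f2, f3] at hCS2
  have hB : 0 ≤ ∑ s ∈ S, ∑ s' ∈ S, w s * w s' * G (s' - s) := by rw [← f3]; exact hKG_psd _
  have hD : ∑ s ∈ S, ∑ s' ∈ S, w s * w s' * G (s' - Function.update s i (2 - s i)) ≤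
      ∑ s ∈ S, ∑ s' ∈ S, w s * w s' * G (s' - s) :=
    (le_abs_self _).trans (abs_le_of_sq_le_sq (by simpa only [sq] using hCS2) hB)
  exact hCS1.trans (mul_le_mul_of_nonneg_left hD ha)

/-- **Registered helper sub-goal `stub_dcfStructure_auxCrossBound`** of stub `stub_dcfStructure` (item
stmt-CriticalPhenomena-4799): the reflection-positivity bound `C² ≤ G(2e_i) B` on the cross term of the
quadratic form of the critical kernel matrix on `{0} ∪ S`, `S ⊂ {x_i ≥ 2}` (`cross_sq_le` at
`G = criticalTwoPoint 3`, fed by `rp_nonneg`, `gram_nonneg`, `twoPointPlus_reflection_invariant_holds` and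
`criticalTwoPoint_neg`). -/
theorem stub_dcfStructure_auxCrossBound :
    ∀ (i : Fin 3) (S : Finset (Site 3)) (w : Site 3 → ℝ), (∀ A : Finset (Site 3), (Matrix.of fun (p q : ↥A)
      => criticalTwoPoint 3 (q.1 - p.1)).PosDef) → (∀ s ∈ S, 2 ≤ s i) → (∑ s ∈ S, w s * criticalTwoPoint 3
      s) ^ 2 ≤ criticalTwoPoint 3 (Pi.single i 2) * ∑ s ∈ S, ∑ s' ∈ S, w s * w s' * criticalTwoPoint 3 (s'
      - s) :=
  fun i S w hpd hS =>
    cross_sq_le (criticalTwoPoint 3) i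
      (fun x => twoPointPlus_reflection_invariant_holds (criticalBeta_nonneg 3) i x) criticalTwoPoint_neg
      (fun p c hp => rp_nonneg i p hp c)
      (fun p c => gram_nonneg (criticalTwoPoint 3) (fun A => (hpd A).posSemidef) p c) S hS w

end Summit.CriticalPhenomena.Ising3DConformalLimit.Cruxes.DirectCorrelationStableTail.SelfEnergyPickInversion

end
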